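import Literature.MathematicalPhysics.QuantumFieldTheory.Balaban1983to89.B13TaxiStarShapedBoxes

/-!
# `Balaban1983to89.B13ScaledPencilTransport` — T. Bałaban, *Propagators for lattice gauge theories in a background field*, Commun. Math. Phys. **99** (1985)
389–434 [Balaban1985BackgroundPropagators], p. 390 («U = U′U₀, U′ = exp iηA»), (3.5) p. 391, (3.35)–(3.37) p. 396 («|A| < O(1)Mα₀(Lʲη)⁻¹ … on □» for a cube of
index `j`; (3.37): «A′ … |A′| < α₁(Lʲη)⁻¹ on Ω_j» — the complex neighbourhood is WEIGHTED BY THE LOCAL SCALE), (3.40) p. 397, Thm 3.4 p. 400; *Renormalization group approach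
to lattice gauge field theories. II*, Commun. Math. Phys. **116** (1988) 1–22 [Balaban1988RG2Cluster] p. 15 («analytic function of (𝐔, 𝐉) in the space 𝐔^c_{k+1}(X, α₀, α₁)»):
THE PENCIL WITH A POINTWISE (SITE-DEPENDENT) RADIUS — per-bond bounds of `e^{iηA′}U₀` from a bound on `A′` AT THAT BOND, and the taxicab word-length bound inside
a box from the radius ON THAT BOX; the (3.37)-SCALED pencil `A″ ↦ e^{iη·w·A″}U₀` as the instance `A′ = w·A″`.

statement-level bookkeeping over pv27's `prodCfg`, node00-def-Y's transporters and stations W1 ∕ W2 (`B13TaxiPathBoundsLocal`, `B13TaxiStarShapedBoxes`), with citation tags;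
kernel-checked; [folklore] `‖exp a‖ ≤ e^{‖a‖}`; nothing here is a claim about the Yang–Mills mass gap; nothing of Bałaban's is asserted; no node is discharged; count-neutral.

WHY THIS FILE (cell `pub-ymgap`, HUMAN RULING D-0062, Track A node N10 = [Balaban1988RG2Cluster] → N06 row 17; width seat `pub-ymgap-dag-n10-w3` g5; station W3 of the located
road's k-uniform re-read; LOCATED (c) bus I.38012, design note I.38899).  The tree's pencil bounds (`B13OpsYPencilTransport.norm_prodCfgV_apply_le`, `norm_parTaxiV_prodCfg_le`)
read ONE global radius `‖A′‖ < Rc` and give `(K₀e^{|η|Rc})^{|x−x′|₁}` for every contour — so the constants of 73∕75∕76∕78 carry `(K₀e^{|η|Rc})^{D}` with the TOP-LEVEL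
range `D = 2(d+1)(L^k − 1)`.  Print weighs `A′` by the local scale ((3.37)): on a block of level `j` the field is `≲ (Lʲη)⁻¹` and the contours have `≲ Lʲ` bonds, the
product staying `O(1)`.  THIS FILE supplies the two leaf facts of that reading: the per-bond bound from the radius AT THE BOND (§1), and the word-length bound inside
a box from the radius ON THE BOX (§2, via W1∕W2) — for the plain pencil read with a site-dependent radius, and for the scaled pencil `A′ = w·A″` (§3).  The
level-by-level re-read of the averaging letters (73) and of 75∕76∕78 over these is the next station.

WHAT THIS FILE PROVES (all `theorem`s; no `def`, no instance, no notation; any torus `P`, `𝔸` a complete normed `ℂ`-algebra with `‖1‖ = 1`).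
§1 `norm_prodCfg_apply_le_of_norm_le` (`‖A′_μ(x)‖ ≤ r`, `‖U₀_μ(x)‖ ≤ K₀` ⟹ `‖(e^{iηA′}U₀)_μ(x)‖ ≤ K₀e^{|η|r}`), `norm_prodCfg_inv_apply_le_of_norm_le` (the reversed bond).
§2 ★★ `norm_parTaxiV_prodCfg_le_of_box` ∕ `_inv_` (`x, x′` in a box of sides `2·s_μ ≤ N`, `‖A′_μ(y)‖ ≤ r` and `‖U₀_μ(y)^{±1}‖ ≤ K₀` for `y` in the box ⟹
   `‖U(Γ_{x,x′})^{±1}‖ ≤ (K₀e^{|η|r})^{|x − x′|₁}` at `U = e^{iηA′}U₀`).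
§3 THE SCALED PENCIL `A′ = w·A″` (`w : Site → ℝ`, `|w| ≤ w₀` on the box, `‖A″‖ < Rc`): `norm_smul_apply_le_of_weight` (`‖(w·A″)_μ(y)‖ ≤ w₀·Rc` on the box),
   ★★ `norm_parTaxiV_scaledPencil_le_of_box` ∕ `_inv_` (`(K₀e^{|η|w₀Rc})^{|x − x′|₁}`).
HONEST FRAMING: [folklore] leaf bounds; which weight (print's `(L^{lev x}η)⁻¹·η`), which boxes (the blocks of the site's level; □̃'s neighbourhood) and the re-read of the
letters are the next stations', displayed here; nothing of Bałaban's asserted; N06 ∕ N10 NOT discharged; no registered stub proved; counts unmoved; one finite 𝕋⁴ programme at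
fixed ε — R4 closes the conditional finite-𝕋⁴ rung `BalabanLadder.UV` only; nothing continuum ∕ ℝ⁴ ∕ OS ∕ mass gap ∕ Clay.  0 `sorry`, 0 `def`, standard axioms.

References: [Balaban1985BackgroundPropagators] p.390, (3.3), (3.5) p.391, (3.35)–(3.37) p.396, (3.40) p.397, Thm 3.4 p.400; [Balaban1988RG2Cluster] (2.5) p.12, p.15;
[Balaban1985Averaging] (52)–(55) pp.27–28.
-/

noncomputable section

namespace Literature.MathematicalPhysics.QuantumFieldTheory.Balaban1983to89.B13ScaledPencilTransport

open Set Complex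
open NormedSpace (exp)
open Literature.MathematicalPhysics.QuantumFieldTheory.Balaban1983to89
open Literature.MathematicalPhysics.QuantumFieldTheory.Balaban1983to89.B9Eq39Adjoint (prodCfg)
open Literature.MathematicalPhysics.QuantumFieldTheory.Balaban1983to89.B9Eq369Product (val_prodCfg val_inv_prodCfg)
open Literature.MathematicalPhysics.QuantumFieldTheory.Balaban1983to89.B9BackgroundsKLevelV1 (CfgV1)
open Literature.MathematicalPhysics.QuantumFieldTheory.Balaban1983to89.Node00 (parTaxiV)
open Literature.MathematicalPhysics.QuantumFieldTheory.Balaban1983to89.B13TaxiStarShapedBoxes (norm_parTaxiV_le_pow_of_box norm_parTaxiV_inv_le_pow_of_box)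
open Literature.MathematicalPhysics.QuantumLattice (norm_exp_le)

variable {𝔸 : Type} [NormedRing 𝔸] [NormedAlgebra ℂ 𝔸] [CompleteSpace 𝔸] [NormOneClass 𝔸]
variable {P : Params} (U₀ : CfgV1 P 𝔸) (η : ℝ) {K₀ : ℝ}

/-! ## §1. Per-bond bounds from the radius at the bond -/

/-- **`‖(e^{iηA′}U₀)_μ(x)‖ ≤ K₀e^{|η|r}` FROM `‖A′_μ(x)‖ ≤ r` AT THAT BOND** (`‖U₀_μ(x)‖ ≤ K₀`, `0 ≤ K₀`): `‖exp(iηA′_μ(x))‖ ≤ e^{|η|‖A′_μ(x)‖}`.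
[cite: Balaban1985BackgroundPropagators, p.390 («U = U′U₀»), (3.35)–(3.37) p.396, Thm 3.4 p.400] -/
theorem norm_prodCfg_apply_le_of_norm_le {μ : Fin P.d} {x : Site P 0} (hU : ‖(U₀ μ x : 𝔸)‖ ≤ K₀) (hK0 : 0 ≤ K₀)
    {a : Fin P.d → Site P 0 → 𝔸} {r : ℝ} (ha : ‖a μ x‖ ≤ r) :
    ‖(prodCfg U₀ η a μ x : 𝔸)‖ ≤ K₀ * Real.exp (|η| * r) := by
  rw [val_prodCfg]
  refine (norm_mul_le _ _).trans ?_
  rw [mul_comm]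
  refine mul_le_mul hU ((norm_exp_le ℂ _).trans (Real.exp_le_exp.2 ?_)) (norm_nonneg _) hK0
  rw [norm_smul, norm_mul, Complex.norm_I, one_mul, Complex.norm_real, Real.norm_eq_abs]
  exact mul_le_mul_of_nonneg_left ha (abs_nonneg η)

/-- **`‖(e^{iηA′}U₀)_μ(x)⁻¹‖ ≤ K₀e^{|η|r}` FROM `‖A′_μ(x)‖ ≤ r`** (`‖U₀_μ(x)⁻¹‖ ≤ K₀`; the reversed bond `U₀(b)⁻¹e^{−iηA′(b)}`, (3.5)).
[cite: Balaban1985BackgroundPropagators, (3.5) p.391, (3.35)–(3.37) p.396, Thm 3.4 p.400] -/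
theorem norm_prodCfg_inv_apply_le_of_norm_le {μ : Fin P.d} {x : Site P 0} (hUi : ‖(((U₀ μ x)⁻¹ : 𝔸ˣ) : 𝔸)‖ ≤ K₀) (hK0 : 0 ≤ K₀)
    {a : Fin P.d → Site P 0 → 𝔸} {r : ℝ} (ha : ‖a μ x‖ ≤ r) :
    ‖(((prodCfg U₀ η a μ x)⁻¹ : 𝔸ˣ) : 𝔸)‖ ≤ K₀ * Real.exp (|η| * r) := by
  rw [val_inv_prodCfg]
  refine (norm_mul_le _ _).trans ?_
  refine mul_le_mul hUi ((norm_exp_le ℂ _).trans (Real.exp_le_exp.2 ?_)) (norm_nonneg _) hK0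
  rw [norm_neg, norm_smul, norm_mul, Complex.norm_I, one_mul, Complex.norm_real, Real.norm_eq_abs]
  exact mul_le_mul_of_nonneg_left ha (abs_nonneg η)

/-! ## §2. ★★ The word-length bound inside a box from the radius on the box -/

/-- ★★ **`‖U(Γ_{x,x′})‖ ≤ (K₀e^{|η|r})^{|x − x′|₁}` AT `U = e^{iηA′}U₀` FROM THE RADIUS ON THE BOX**: `x, x′` in the box `{y : ∀ μ, (y μ − c μ).val < s μ}` with `2·s μ ≤ N`,
`‖A′_μ(y)‖ ≤ r` and `‖U₀_μ(y)^{±1}‖ ≤ K₀` for the bonds based at box points (W2 `norm_parTaxiV_le_pow_of_box` + §1) — the contour's bonds are weighed by the field ON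
THEIR OWN BOX, as in (3.35)–(3.37). [cite: Balaban1985BackgroundPropagators, (3.3) p.391, (3.35)–(3.37) p.396, (3.40) p.397, Thm 3.4 p.400; Balaban1985Averaging, (52)–(55) pp.27–28] -/
theorem norm_parTaxiV_prodCfg_le_of_box (c : Site P 0) (s : Fin P.d → ℕ) (hs : ∀ μ, 2 * s μ ≤ P.sitesPerDir 0) (hK0 : 0 ≤ K₀)
    (hU : ∀ μ y, (∀ ν, (y ν - c ν).val < s ν) → ‖(U₀ μ y : 𝔸)‖ ≤ K₀) (hUi : ∀ μ y, (∀ ν, (y ν - c ν).val < s ν) → ‖(((U₀ μ y)⁻¹ : 𝔸ˣ) : 𝔸)‖ ≤ K₀)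
    {a : Fin P.d → Site P 0 → 𝔸} {r : ℝ} (ha : ∀ μ y, (∀ ν, (y ν - c ν).val < s ν) → ‖a μ y‖ ≤ r)
    {x x' : Site P 0} (hx : ∀ μ, (x μ - c μ).val < s μ) (hx' : ∀ μ, (x' μ - c μ).val < s μ) :
    ‖(parTaxiV (prodCfg U₀ η a) x x' : 𝔸)‖ ≤ (K₀ * Real.exp (|η| * r)) ^ Site.tdist x x' :=
  norm_parTaxiV_le_pow_of_box (prodCfg U₀ η a) c s hs (fun μ y hy => norm_prodCfg_apply_le_of_norm_le U₀ η (hU μ y hy) hK0 (ha μ y hy))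
    (fun μ y hy => norm_prodCfg_inv_apply_le_of_norm_le U₀ η (hUi μ y hy) hK0 (ha μ y hy)) hx hx'

/-- ★★ **… and `‖U(Γ_{x,x′})⁻¹‖ ≤ (K₀e^{|η|r})^{|x − x′|₁}`**. [cite: Balaban1985BackgroundPropagators, (3.3), (3.5) p.391, (3.35)–(3.37) p.396, (3.40) p.397] -/
theorem norm_parTaxiV_inv_prodCfg_le_of_box (c : Site P 0) (s : Fin P.d → ℕ) (hs : ∀ μ, 2 * s μ ≤ P.sitesPerDir 0) (hK0 : 0 ≤ K₀)
    (hU : ∀ μ y, (∀ ν, (y ν - c ν).val < s ν) → ‖(U₀ μ y : 𝔸)‖ ≤ K₀) (hUi : ∀ μ y, (∀ ν, (y ν - c ν).val < s ν) → ‖(((U₀ μ y)⁻¹ : 𝔸ˣ) : 𝔸)‖ ≤ K₀)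
    {a : Fin P.d → Site P 0 → 𝔸} {r : ℝ} (ha : ∀ μ y, (∀ ν, (y ν - c ν).val < s ν) → ‖a μ y‖ ≤ r)
    {x x' : Site P 0} (hx : ∀ μ, (x μ - c μ).val < s μ) (hx' : ∀ μ, (x' μ - c μ).val < s μ) :
    ‖(((parTaxiV (prodCfg U₀ η a) x x')⁻¹ : 𝔸ˣ) : 𝔸)‖ ≤ (K₀ * Real.exp (|η| * r)) ^ Site.tdist x x' :=
  norm_parTaxiV_inv_le_pow_of_box (prodCfg U₀ η a) c s hs (fun μ y hy => norm_prodCfg_apply_le_of_norm_le U₀ η (hU μ y hy) hK0 (ha μ y hy))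
    (fun μ y hy => norm_prodCfg_inv_apply_le_of_norm_le U₀ η (hUi μ y hy) hK0 (ha μ y hy)) hx hx'

/-! ## §3. The scaled pencil `A′ = w·A″`: radius `w₀·Rc` on a box where `|w| ≤ w₀` -/

omit [CompleteSpace 𝔸] [NormOneClass 𝔸] in
/-- **THE SCALED FIELD ON A BOX**: `‖A″‖ < Rc` (sup norm) and `|w(y)| ≤ w₀` ⟹ `‖(w(y)·A″_μ(y))‖ ≤ w₀·Rc` — the weight of (3.37) read at the site.
[cite: Balaban1985BackgroundPropagators, (3.37) p.396 («|A′| < α₁(Lʲη)⁻¹ on Ω_j»), bookkeeping] -/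
theorem norm_smul_apply_le_of_weight {w : Site P 0 → ℝ} {w₀ Rc : ℝ} (hw0 : 0 ≤ w₀) {a : Fin P.d → Site P 0 → 𝔸}
    (ha : a ∈ Metric.ball (0 : Fin P.d → Site P 0 → 𝔸) Rc) {μ : Fin P.d} {y : Site P 0} (hw : |w y| ≤ w₀) :
    ‖(((w y : ℝ) : ℂ) • a μ y)‖ ≤ w₀ * Rc := by
  have haμ : ‖a μ y‖ ≤ Rc := ((norm_le_pi_norm (a μ) y).trans (norm_le_pi_norm a μ)).trans (mem_ball_zero_iff.1 ha).le
  rw [norm_smul, Complex.norm_real, Real.norm_eq_abs]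
  exact mul_le_mul hw haμ (norm_nonneg _) hw0

/-- ★★ **THE SCALED PENCIL's WORD-LENGTH BOUND INSIDE A BOX**: at `U = e^{iη·(w·A″)}U₀` with `‖A″‖ < Rc`, `|w| ≤ w₀` on the box (`2·s μ ≤ N`, `x, x′` in the box,
`‖U₀(b)^{±1}‖ ≤ K₀` on the box): `‖U(Γ_{x,x′})‖ ≤ (K₀e^{|η|w₀Rc})^{|x − x′|₁}` — on a block of level `j` with `w = L^{−j}` and `|x − x′|₁ ≲ (d+1)Lʲ` the exponent stays
`O((d+1)|η|Rc)`, UNIFORMLY IN THE LEVEL. [cite: Balaban1985BackgroundPropagators, (3.35)–(3.37) p.396, (3.40) p.397, Thm 3.4 p.400; Balaban1988RG2Cluster, p.15] -/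
theorem norm_parTaxiV_scaledPencil_le_of_box (c : Site P 0) (s : Fin P.d → ℕ) (hs : ∀ μ, 2 * s μ ≤ P.sitesPerDir 0) (hK0 : 0 ≤ K₀)
    (hU : ∀ μ y, (∀ ν, (y ν - c ν).val < s ν) → ‖(U₀ μ y : 𝔸)‖ ≤ K₀) (hUi : ∀ μ y, (∀ ν, (y ν - c ν).val < s ν) → ‖(((U₀ μ y)⁻¹ : 𝔸ˣ) : 𝔸)‖ ≤ K₀)
    (w : Site P 0 → ℝ) {w₀ Rc : ℝ} (hw0 : 0 ≤ w₀) (hw : ∀ y, (∀ ν, (y ν - c ν).val < s ν) → |w y| ≤ w₀)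
    {a : Fin P.d → Site P 0 → 𝔸} (ha : a ∈ Metric.ball (0 : Fin P.d → Site P 0 → 𝔸) Rc)
    {x x' : Site P 0} (hx : ∀ μ, (x μ - c μ).val < s μ) (hx' : ∀ μ, (x' μ - c μ).val < s μ) :
    ‖(parTaxiV (prodCfg U₀ η (fun μ y => ((w y : ℝ) : ℂ) • a μ y)) x x' : 𝔸)‖ ≤ (K₀ * Real.exp (|η| * (w₀ * Rc))) ^ Site.tdist x x' :=
  norm_parTaxiV_prodCfg_le_of_box U₀ η c s hs hK0 hU hUi (fun _ y hy => norm_smul_apply_le_of_weight hw0 ha (hw y hy)) hx hx'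

/-- ★★ **… and its inverse**. [cite: Balaban1985BackgroundPropagators, (3.5) p.391, (3.35)–(3.37) p.396, (3.40) p.397] -/
theorem norm_parTaxiV_inv_scaledPencil_le_of_box (c : Site P 0) (s : Fin P.d → ℕ) (hs : ∀ μ, 2 * s μ ≤ P.sitesPerDir 0) (hK0 : 0 ≤ K₀)
    (hU : ∀ μ y, (∀ ν, (y ν - c ν).val < s ν) → ‖(U₀ μ y : 𝔸)‖ ≤ K₀) (hUi : ∀ μ y, (∀ ν, (y ν - c ν).val < s ν) → ‖(((U₀ μ y)⁻¹ : 𝔸ˣ) : 𝔸)‖ ≤ K₀)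
    (w : Site P 0 → ℝ) {w₀ Rc : ℝ} (hw0 : 0 ≤ w₀) (hw : ∀ y, (∀ ν, (y ν - c ν).val < s ν) → |w y| ≤ w₀)
    {a : Fin P.d → Site P 0 → 𝔸} (ha : a ∈ Metric.ball (0 : Fin P.d → Site P 0 → 𝔸) Rc)
    {x x' : Site P 0} (hx : ∀ μ, (x μ - c μ).val < s μ) (hx' : ∀ μ, (x' μ - c μ).val < s μ) :
    ‖(((parTaxiV (prodCfg U₀ η (fun μ y => ((w y : ℝ) : ℂ) • a μ y)) x x')⁻¹ : 𝔸ˣ) : 𝔸)‖ ≤ (K₀ * Real.exp (|η| * (w₀ * Rc))) ^ Site.tdist x x' :=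
  norm_parTaxiV_inv_prodCfg_le_of_box U₀ η c s hs hK0 hU hUi (fun _ y hy => norm_smul_apply_le_of_weight hw0 ha (hw y hy)) hx hx'

end Literature.MathematicalPhysics.QuantumFieldTheory.Balaban1983to89.B13ScaledPencilTransport
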